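import Summits.Schanuel.Schanuel.Theorems.RootDecomp1KNW96Core03
import Literature.NumberTheory.Transcendental.PiTranscendenceMeasureMain
import Literature.NumberTheory.Transcendental.PiTranscendenceMeasureParams
import Literature.NumberTheory.Transcendental.ExpLogSimultaneousApproximationMeasure

/-!
# RootDecomp1KNW96Core — lens 6, generation 23 «NW96 THEOREM 1, c = 400, HYPOTHESIS-FREE» (PROGRAMME G23-b; VERDICT L2175: THEOREM ×1): `theorem nw1996MainR_400 : NW1996MainR 400` — Nesterenko–Waldschmidt 1996 Theorem 1 (first assertion) with the absolute constant 400 in place of the printed 211, SORRY-FREE, NO hypothesis, NO named fact; = `core` (parts 01–03) + the glue `mainR_of_paramsOK : ParamsOK c → NW1996MainR c` + the audited repair parameters `paramsOK_400` (S = ⌊25UV⌋, S₁ = ⌊9DW+½⌋, T = ⌊33DVW⌋, T₁ = ⌊5U+½⌋, H = ⌊1.1 W log E⌋, ε = E^{−400DUVW}) — continuation (RootDecomp1KNW96Core04): §4 glue ParamsOK / mainR_of_paramsOK + §5 ParamsA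

(lens-6 g23 HOME kernel g23b/NW96Main.lean 5c2fab87…, 2022 l = NW96Core.lean body byte-identical (ported as parts 01–03) + §4–§6; extra imports Literature PiTranscendenceMeasureMain + PiTranscendenceMeasureParams + ExpLogSimultaneousApproximationMeasure (the def `NW1996MainR`, census p828340); NODE L2171 / REQUEST L2172 / ADDENDUM L2174, writer re-check L2173, critic VERDICT L2175 (CLEARED — THEOREM ×1 (G23-b); lens-6 tally THEOREM ×6 + CELL ×3 + AUDIT ×1; RULE G24; PORT GO priority HIGH, Summit-side first; Literature relocation of `nw1996MainR_400` next to the cite-tagged fact = later census pass); port by census-1 gen 18 as `RootDecomp1KNW96Core04`–`07`: 04 = §4 the glue `ParamsOK`, `mainR_of_paramsOK` + §5 ParamsA; 05 = §5 ParamsB + ParamsC; 06 = §5 ParamsD; 07 = §5 ParamsE (`paramsOK_400`, scoped `maxHeartbeats 1000000` as in K) + §6 the headline `nw1996MainR_400`.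
PORT EDITS: `set_option linter.dupNamespace false` and `import HarnessLib` dropped; parts 01–03 untouched; statements and proofs verbatim. `--supports stmt-Schanuel-33364`; no census credit carried; rung 0 — nothing here proves Schanuel. CONSEQUENCE OF RECORD: the registered fact `NesterenkoWaldschmidt1996_thm_1` (constant 211, PRINT-CLAIM · PROOF-GAP per the g22 audit) now has a PROVED weaker-constant companion in the tree; RULE G24 (critic L2175) governs the consumer re-typing generic in c.)
-/

noncomputable section

open Finset

namespace Summit.Schanuel.Schanuel.Theorems.RootDecomp1KNW96Core

open Literature.NumberTheory.Transcendental

/-! ## §4. The glue to the registered statement: `ParamsOK c → NW1996MainR c` (PROGRAMME G23-b, part 1)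

`NW1996MainR c` (tree, `ExpLogSimultaneousApproximationMeasure.lean`) is the text of the registered fact
with the numeral `211` replaced by `c`.  The theorem `mainR_of_paramsOK` below reduces it, via `core`, to
the PURELY REAL-ARITHMETIC statement `ParamsOK c`: for every real datum `(D, log A, log B, E, |θ|)` of the
theorem there are natural parameters `H, T, T₁, S, S₁` (and reals `R, B, M`) satisfying (2.1), the two
analytic comparisons of `core` with `ε = exp(−expo)` in place of `|e^θ − α| + |θ − β|`, and `core`'s main
inequality with `Dr = D`, `Hβ = D log B`, `Hα = D log A`, `lν = (23/20)·H` (`NWPi.log_lcmUpto_le`).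
All field theory, heights and complex analysis are discharged here once; what remains for
`NW1996MainR 400` is `ParamsOK 400` — the parameter choice `S = [25UV]`, `S₁ = [9DW + ½]`, `T = [33DVW]`,
`T₁ = [5U + ½]`, `H = [1.1 W log E]` of the audited repair scheme and its budget (pattern of the tree's
`PiTranscendenceMeasureParams.lean`), not done in this file. -/

section MainGlue

open Complex

/-- The exponent of Theorem 1 with constant `c` as a function of the real data
`(D, lA, lB, E, r) = ([K:ℚ], log A, log B, E, |θ|)`:
`c·D·(lB + log lA + 4 log D + 2 log(E·max(1,r)) + 10)·(D·lA + 2E r + 6 log E)·(3.3 D log(D+2) + log E)/(log E)²`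
— VERBATIM the (negated) argument of `Real.exp` in `NW1996MainR c`. -/
def expo (c : ℝ) (D : ℕ) (lA lB E r : ℝ) : ℝ :=
  c * (D : ℝ) * (lB + Real.log lA + 4 * Real.log (D : ℝ) + 2 * Real.log (E * max 1 r) + 10) *
      ((D : ℝ) * lA + 2 * E * r + 6 * Real.log E) *
      ((33 / 10 : ℝ) * (D : ℝ) * Real.log ((D : ℝ) + 2) + Real.log E) /
    Real.log E ^ 2

/-- **The arithmetic residue of Theorem 1 with constant `c`.**  For all real data `D ≥ 1`,
`lA ≥ 1/D`, `lB ≥ 0`, `E ≥ e`, `r ≥ 0` there are parameters `H, T, T₁, S, S₁, L, m ∈ ℕ` and reals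
`R, B, M` with: `L = (T+1)(2T₁+1)`, `m = S₁(T+1)T₁(T₁+1)`, `H ≥ 1`, `T₁ ≥ 1`, (2.1); the norm bounds
`max(1,r) + ε ≤ R`, `e^r + ε ≤ B`, `ε < e^{−r}`, `(e^{−r} − ε)⁻¹ ≤ B` (`ε = exp(−expo c D lA lB E r)`);
the analytic comparison `hMf` of `core` (with `|θ| = r`); the perturbation comparison `hMp` of `core` with
`S|β − θ| + T₁S₁|α − e^θ|` replaced by `(S + T₁S₁)·ε`; and `core`'s main inequality with `Dr = D`,
`Hβ = D·lB`, `Hα = D·lA`, `lν = (23/20)·H`.  Purely a statement about real numbers. -/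
def ParamsOK (c : ℝ) : Prop :=
  ∀ (D : ℕ) (lA lB E r : ℝ), 1 ≤ D → 1 / (D : ℝ) ≤ lA → 0 ≤ lB → Real.exp 1 ≤ E → 0 ≤ r →
    ∃ (H T T₁ S S₁ L m : ℕ) (R B M : ℝ),
      L = (T + 1) * (2 * T₁ + 1) ∧ m = S₁ * (T + 1) * (T₁ * (T₁ + 1)) ∧
      1 ≤ H ∧ 1 ≤ T₁ ∧ 2 * T₁ ≤ S + 1 ∧ (2 * T₁ + 1) * T < (S + 1 - 2 * T₁) * (2 * S₁ + 1) ∧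
      max 1 r + Real.exp (-expo c D lA lB E r) ≤ R ∧
      Real.exp r + Real.exp (-expo c D lA lB E r) ≤ B ∧
      Real.exp (-expo c D lA lB E r) < Real.exp (-r) ∧
      (Real.exp (-r) - Real.exp (-expo c D lA lB E r))⁻¹ ≤ B ∧
      (S : ℝ) ^ S * Real.exp ((T : ℝ) + H) * (1 + E * S₁ / H) ^ T * (R * T₁) ^ S *
          Real.exp (r * T₁ * (E * S₁)) ≤ Real.exp M ∧
      (S : ℝ) ^ S * Real.exp ((T : ℝ) + H) * (1 + (S₁ : ℝ) / H) ^ T * (T₁ : ℝ) ^ S *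
          (R ^ S * B ^ (T₁ * S₁ + 1) *
            (((S : ℝ) + ((T₁ * S₁ : ℕ) : ℝ)) * Real.exp (-expo c D lA lB E r))) *
          E ^ L ≤ Real.exp M ∧
      (L : ℝ) * Real.log 2 + (D : ℝ) * L * Real.log L +
          ((D : ℝ) - 1) * L * (S * ((23 / 20 : ℝ) * (H : ℝ)) + S * Real.log T₁ + S * Real.log S +
            ((T : ℝ) + H) + T * Real.log (1 + (S₁ : ℝ) / H)) +
          L * S * ((D : ℝ) * lB) + 2 * m * ((D : ℝ) * lA) + m * Real.log B +
          L * S * ((23 / 20 : ℝ) * (H : ℝ)) + L * M + L * S * Real.log E <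
        (L : ℝ) * ((L : ℝ) - 1) / 2 * Real.log E

/-- **G23-b glue: Theorem 1 with constant `c` from its arithmetic residue.**
`ParamsOK c → NW1996MainR c`, by `core` applied in `F = ℚ(α, β)` with `Dr = D = [F:ℚ]`,
`Hβ = D log B`, `Hα = D log A` (from `h(β) ≤ log B`, `h(α) ≤ max(h(α), 1/D) ≤ log A`),
`lν = (23/20)H` (`NWPi.log_lcmUpto_le`), and the norm bounds `|β| ≤ |θ| + ε`, `|α| ≤ e^{|θ|} + ε`,
`|α|⁻¹ ≤ (e^{−|θ|} − ε)⁻¹`, `|e^θ|^{±1} ≤ e^{|θ|}` under the negation `|e^θ − α| + |θ − β| < ε` of the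
conclusion.  Fact-free; `θ ≠ 0` is not used. [cite: NesterenkoWaldschmidt1996, Theorem 1 and §6] -/
theorem mainR_of_paramsOK {c : ℝ} (hP : ParamsOK c) : NW1996MainR c := by
  intro θ α β A B₀ E _hθ0 hα0 hβ0 hαalg hβalg _hA _hB₀ hE hlA hlB
  set K := IntermediateField.adjoin ℚ ({α, β} : Set ℂ) with hK
  haveI hKfd : FiniteDimensional ℚ K := by
    refine IntermediateField.finiteDimensional_adjoin (fun x hx => ?_)
    simp only [Set.mem_insert_iff, Set.mem_singleton_iff] at hx
    rcases hx with rfl | rfl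
    · exact isAlgebraic_iff_isIntegral.mp hαalg
    · exact isAlgebraic_iff_isIntegral.mp hβalg
  have hD1 : 1 ≤ Module.finrank ℚ K := Module.finrank_pos
  have hαK : α ∈ K := IntermediateField.subset_adjoin ℚ _ (by simp)
  have hβK : β ∈ K := IntermediateField.subset_adjoin ℚ _ (by simp)
  by_contra hlt
  rw [not_le] at hlt
  -- the real data of the theorem
  have hlA' : 1 / (Module.finrank ℚ K : ℝ) ≤ Real.log A := le_trans (le_max_right _ _) hlA
  have hhα : weilHeight₁ K (fun _ : Unit => α) ≤ Real.log A := le_trans (le_max_left _ _) hlA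
  have hlB' : 0 ≤ Real.log B₀ := le_trans (weilHeight₁_nonneg K _) hlB
  obtain ⟨H, T, T₁, S, S₁, L, m, R, B, M, hL, hm, hH, hT₁, h2T₁, hcount, hR, hBa, hεr, hBi,
      hMf, hMp, hmain⟩ :=
    hP (Module.finrank ℚ K) (Real.log A) (Real.log B₀) E ‖θ‖ hD1 hlA' hlB' hE (norm_nonneg θ)
  obtain ⟨ε, hε⟩ : ∃ ε : ℝ,
      ε = Real.exp (-expo c (Module.finrank ℚ K) (Real.log A) (Real.log B₀) E ‖θ‖) := ⟨_, rfl⟩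
  rw [← hε] at hR hBa hεr hBi hMp
  have hε0 : 0 < ε := by rw [hε]; exact Real.exp_pos _
  have hsmall : ‖cexp θ - α‖ + ‖θ - β‖ < ε := by rw [hε]; exact hlt
  -- elementary norm bounds under `|e^θ − α| + |θ − β| < ε`
  have h1 : ‖θ - β‖ < ε := lt_of_le_of_lt (le_add_of_nonneg_left (norm_nonneg _)) hsmall
  have h2 : ‖cexp θ - α‖ < ε := lt_of_le_of_lt (le_add_of_nonneg_right (norm_nonneg _)) hsmall
  have hβθ : ‖β - θ‖ < ε := by rwa [norm_sub_rev] at h1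
  have hαw : ‖α - cexp θ‖ < ε := by rwa [norm_sub_rev] at h2
  have hw : ‖cexp θ‖ = Real.exp θ.re := Complex.norm_exp θ
  have hre : θ.re ≤ ‖θ‖ := Complex.re_le_norm θ
  have hre' : -‖θ‖ ≤ θ.re := (abs_le.mp (Complex.abs_re_le_norm θ)).1
  have hwle : ‖cexp θ‖ ≤ Real.exp ‖θ‖ := by rw [hw]; exact Real.exp_le_exp.mpr hre
  have hwge : Real.exp (-‖θ‖) ≤ ‖cexp θ‖ := by rw [hw]; exact Real.exp_le_exp.mpr hre'
  have hE1 : 1 ≤ E := le_trans (Real.one_le_exp (by norm_num)) hE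
  have hmax1 : (1 : ℝ) ≤ max 1 ‖θ‖ := le_max_left _ _
  have hmaxθ : ‖θ‖ ≤ max 1 ‖θ‖ := le_max_right _ _
  have hR1 : 1 ≤ R := by linarith
  have hθR : ‖θ‖ ≤ R := by linarith
  have hβR : ‖β‖ ≤ R := by
    have := norm_sub_norm_le β θ
    linarith
  have heθ : 1 ≤ Real.exp ‖θ‖ := Real.one_le_exp (norm_nonneg θ)
  have hB1 : 1 ≤ B := by linarith
  have hαB : ‖α‖ ≤ B := by
    have := norm_sub_norm_le α (cexp θ)
    linarith
  have hwB : ‖cexp θ‖ ≤ B := by linarith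
  have hwB' : ‖cexp θ‖⁻¹ ≤ B := by
    have hpos : 0 < Real.exp (-‖θ‖) := Real.exp_pos _
    calc ‖cexp θ‖⁻¹ ≤ (Real.exp (-‖θ‖))⁻¹ := inv_anti₀ hpos hwge
      _ = Real.exp ‖θ‖ := by rw [Real.exp_neg, inv_inv]
      _ ≤ B := by linarith
  have hαlow : Real.exp (-‖θ‖) - ε ≤ ‖α‖ := by
    have := norm_sub_norm_le (cexp θ) α
    linarith
  have hαB' : ‖α‖⁻¹ ≤ B := by
    have hpos : 0 < Real.exp (-‖θ‖) - ε := by linarith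
    calc ‖α‖⁻¹ ≤ (Real.exp (-‖θ‖) - ε)⁻¹ := inv_anti₀ hpos hαlow
      _ ≤ B := hBi
  have hlν := NWPi.log_lcmUpto_le H
  -- the perturbation comparison of `core` from `hMp`
  have hMp' : (S : ℝ) ^ S * Real.exp ((T : ℝ) + H) * (1 + (S₁ : ℝ) / H) ^ T * (T₁ : ℝ) ^ S *
      (R ^ S * B ^ (T₁ * S₁ + 1) * ((S : ℝ) * ‖β - θ‖ + ((T₁ * S₁ : ℕ) : ℝ) * ‖α - cexp θ‖)) *
      E ^ L ≤ Real.exp M := by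
    refine le_trans ?_ hMp
    have hin : (S : ℝ) * ‖β - θ‖ + ((T₁ * S₁ : ℕ) : ℝ) * ‖α - cexp θ‖ ≤
        ((S : ℝ) + ((T₁ * S₁ : ℕ) : ℝ)) * ε := by
      rw [add_mul]
      exact add_le_add (mul_le_mul_of_nonneg_left hβθ.le (Nat.cast_nonneg _))
        (mul_le_mul_of_nonneg_left hαw.le (Nat.cast_nonneg _))
    have hP0 : 0 ≤ (S : ℝ) ^ S * Real.exp ((T : ℝ) + H) * (1 + (S₁ : ℝ) / H) ^ T * (T₁ : ℝ) ^ S := by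
      positivity
    have hR0 : 0 ≤ R := by linarith
    have hB0 : 0 ≤ B := by linarith
    have hRB : 0 ≤ R ^ S * B ^ (T₁ * S₁ + 1) := mul_nonneg (pow_nonneg hR0 _) (pow_nonneg hB0 _)
    have hEL : 0 ≤ E ^ L := pow_nonneg (by linarith) _
    exact mul_le_mul_of_nonneg_right
      (mul_le_mul_of_nonneg_left (mul_le_mul_of_nonneg_left hin hRB) hP0) hEL
  -- heights in `K = ℚ(α, β)`
  have hfin0 : (0 : ℝ) ≤ (Module.finrank ℚ K : ℝ) := Nat.cast_nonneg _
  have hHβ : (Module.finrank ℚ K : ℝ) * weilHeight₁ K (fun _ : Unit => β) ≤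
      (Module.finrank ℚ K : ℝ) * Real.log B₀ := mul_le_mul_of_nonneg_left hlB hfin0
  have hHα : (Module.finrank ℚ K : ℝ) * weilHeight₁ K (fun _ : Unit => α) ≤
      (Module.finrank ℚ K : ℝ) * Real.log A := mul_le_mul_of_nonneg_left hhα hfin0
  exact core hα0 hβ0 K hβK hαK le_rfl hHβ hHα hH hT₁ h2T₁ hcount hL hm hE1 hR1 hβR hθR hB1 hαB
    hαB' hwB hwB' hlν hMf hMp' hmain

end MainGlue

/-! ## §5. The parameters: `ParamsOK 400` (PROGRAMME G23-b, part 2)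

# NW96 Theorem 1 with constant `400` — the parameters (PROGRAMME G23-b, part 2: `ParamsOK 400`)

The arithmetic residue `ParamsOK 400` of `mainR_of_paramsOK` (`NW96CoreMain.lean` §4): the audited repair
scheme of REPAIR-v2 §4 (decomp-schanuel lens 6, g22) — `S = ⌊25UV⌋`, `S₁ = ⌊9DW + ½⌋`, `T = ⌊33DVW⌋`,
`T₁ = ⌊5U + ½⌋`, `H = ⌊1.1 W log E⌋`, `ε = E^{−400DUVW}`, with `U log E = 3.3 D log(D+2) + log E`,
`V log E = D log A + 2E|θ| + 6 log E`, `W log E = log B + log log A + 4 log D + 2 log(E|θ|₊) + 10` — in the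
pattern of the tree's `PiTranscendenceMeasureParams.lean` (there `E = e²` is fixed; here `E ≥ e` is
symbolic, `ℓ = log E ≥ 1`).  Elementary real inequalities only; every majorant is a lemma.
Budget per row of the determinant, in units of `Ψℓ` (`Ψ = DUVW`, `ℓ = log E`):
`55.5 + 33 + 28.125 + 44.54 = 161.165 < 165` (lemmas `group1`–`group4`, `row_lt`; REPAIR-v2 §3′ table R-400
with ¼ unit of slack moved into group (iii)).

## References
* [NesterenkoWaldschmidt1996] Yu. V. Nesterenko, M. Waldschmidt, *On the approximation of the values of
  exponential function and logarithm by algebraic numbers*, Mat. Zapiski 2 (1996) 23–42 (arXiv:math/0002047), §6.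
-/

section Params

open Real

section ParamsA

/-! ### A. The real data `(D, lA, lB, E, r)` and the functions `ℓ, u, v, w` -/

/-- `log y ≤ y / e` for `y > 0`. [folklore] -/
theorem log_le_div_exp_one {y : ℝ} (hy : 0 < y) : log y ≤ y / exp 1 := by
  have h1 : log (y / exp 1) ≤ y / exp 1 - 1 := Real.log_le_sub_one_of_pos (by positivity)
  rw [Real.log_div hy.ne' (Real.exp_pos 1).ne', Real.log_exp] at h1
  linarith

/-- `log y ≤ 0.37 y` for `y > 0`. [folklore] -/
theorem log_le_mul {y : ℝ} (hy : 0 < y) : log y ≤ 0.37 * y := by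
  have h1 := log_le_div_exp_one hy
  have h2 : y / exp 1 ≤ y / 2.718 := div_le_div_of_nonneg_left hy.le (by norm_num) NWPi.e_bounds'.1.le
  have h3 : y / 2.718 ≤ 0.37 * y := by rw [div_le_iff₀ (by norm_num)]; nlinarith
  linarith

/-- **The data bounds.** For `D ≥ 1`, `lA ≥ 1/D`, `lB ≥ 0`, `E ≥ e`, `r ≥ 0` and `ℓ = log E`,
`u = 3.3 D log(D+2) + ℓ`, `v = D lA + 2E r + 6ℓ`, `w = lB + log lA + 4 log D + 2 log(E max(1,r)) + 10`:
`1 ≤ ℓ`, `2.718 ≤ E`, `0 < lA`, `1 ≤ D lA`, `−log D ≤ log lA`, `3.3 + ℓ ≤ u`, `1 + 6ℓ ≤ v`, `2E r ≤ v`,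
`2ℓ + 10 ≤ w`, and `log(E max(1,r)) = ℓ + log max(1,r)` with `0 ≤ log max(1,r)`. [folklore] -/
theorem data_bounds (Dn : ℕ) (hDn : 1 ≤ Dn) {lA lB E r ℓ u v w : ℝ} (hlA : 1 / (Dn : ℝ) ≤ lA)
    (hlB : 0 ≤ lB) (hE : exp 1 ≤ E) (hr : 0 ≤ r) (hℓ : ℓ = log E)
    (hu : u = 33 / 10 * (Dn : ℝ) * log ((Dn : ℝ) + 2) + ℓ) (hv : v = (Dn : ℝ) * lA + 2 * E * r + 6 * ℓ)
    (hw : w = lB + log lA + 4 * log (Dn : ℝ) + 2 * log (E * max 1 r) + 10) :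
    1 ≤ ℓ ∧ 2.718 ≤ E ∧ (0 < lA ∧ 1 ≤ (Dn : ℝ) * lA ∧ -log (Dn : ℝ) ≤ log lA) ∧ 33 / 10 + ℓ ≤ u ∧
      (1 + 6 * ℓ ≤ v ∧ 2 * E * r ≤ v) ∧ 2 * ℓ + 10 ≤ w ∧
      (log (E * max 1 r) = ℓ + log (max 1 r) ∧ 0 ≤ log (max 1 r)) := by
  have hD : (1 : ℝ) ≤ Dn := by exact_mod_cast hDn
  have hD0 : (0 : ℝ) < Dn := by linarith
  have hE1 : 2.718 ≤ E := le_trans NWPi.e_bounds'.1.le hE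
  have hE0 : 0 < E := by linarith
  have hℓ1 : 1 ≤ ℓ := by
    rw [hℓ, ← Real.log_exp 1]; exact Real.log_le_log (Real.exp_pos 1) hE
  have hlA0 : 0 < lA := lt_of_lt_of_le (by positivity) hlA
  have hDlA : 1 ≤ (Dn : ℝ) * lA := by
    have := mul_le_mul_of_nonneg_left hlA hD0.le
    rwa [mul_one_div_cancel hD0.ne'] at this
  have hloglA : -log (Dn : ℝ) ≤ log lA := by
    have := Real.log_le_log (by positivity) hlA
    rwa [one_div, Real.log_inv] at this
  have hlog3 : 1 ≤ log ((Dn : ℝ) + 2) :=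
    NWPi.one_le_log_three.trans (Real.log_le_log (by norm_num) (by linarith))
  have hu1 : 33 / 10 + ℓ ≤ u := by
    rw [hu]
    have : 33 / 10 * (1 : ℝ) * 1 ≤ 33 / 10 * (Dn : ℝ) * log ((Dn : ℝ) + 2) :=
      mul_le_mul (mul_le_mul_of_nonneg_left hD (by norm_num)) hlog3 (by norm_num) (by positivity)
    linarith
  have hmax1 : (1 : ℝ) ≤ max 1 r := le_max_left _ _
  have hlogmax : 0 ≤ log (max 1 r) := Real.log_nonneg hmax1
  have hlogEr : log (E * max 1 r) = ℓ + log (max 1 r) := by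
    rw [Real.log_mul hE0.ne' (by positivity), hℓ]
  have hlogD : 0 ≤ log (Dn : ℝ) := Real.log_nonneg hD
  have hEr : 0 ≤ 2 * E * r := by positivity
  refine ⟨hℓ1, hE1, ⟨hlA0, hDlA, hloglA⟩, hu1, ⟨?_, ?_⟩, ?_, hlogEr, hlogmax⟩
  · rw [hv]; linarith
  · rw [hv]; linarith
  · rw [hw, hlogEr]; linarith

/-- **The normalised data `U = u/ℓ`, `V = v/ℓ`, `W = w/ℓ`**: `1 ≤ U`, `6 ≤ V`, `2 ≤ W`, `12 ≤ Wℓ`,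
`U ≤ u`, and `Ψ = DUVW ≥ 12 D`. [folklore] -/
theorem UVW_bounds {D ℓ u v w U V W : ℝ} (hD : 1 ≤ D) (hℓ : 1 ≤ ℓ) (hu : 33 / 10 + ℓ ≤ u)
    (hv : 1 + 6 * ℓ ≤ v) (hw : 2 * ℓ + 10 ≤ w) (hU : U = u / ℓ) (hV : V = v / ℓ) (hW : W = w / ℓ) :
    1 ≤ U ∧ 6 ≤ V ∧ 2 ≤ W ∧ 12 ≤ W * ℓ ∧ U ≤ u ∧ U * ℓ = u ∧ V * ℓ = v ∧ W * ℓ = w ∧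
      12 * D ≤ D * U * V * W := by
  have hℓ0 : 0 < ℓ := by linarith
  have hU1 : 1 ≤ U := by rw [hU, le_div_iff₀ hℓ0]; linarith
  have hV6 : 6 ≤ V := by rw [hV, le_div_iff₀ hℓ0]; linarith
  have hW2 : 2 ≤ W := by rw [hW, le_div_iff₀ hℓ0]; linarith
  have hUu : U * ℓ = u := by rw [hU]; field_simp
  have hVv : V * ℓ = v := by rw [hV]; field_simp
  have hWw : W * ℓ = w := by rw [hW]; field_simp
  have hWℓ : 12 ≤ W * ℓ := by rw [hWw]; linarith
  have hUle : U ≤ u := by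
    rw [hU, div_le_iff₀ hℓ0]
    have : 0 ≤ u := by linarith
    nlinarith
  refine ⟨hU1, hV6, hW2, hWℓ, hUle, hUu, hVv, hWw, ?_⟩
  have h1 : 1 * 6 * 2 ≤ U * V * W := by
    have h12 : 1 * 6 ≤ U * V := mul_le_mul hU1 hV6 (by norm_num) (by linarith)
    exact mul_le_mul h12 hW2 (by norm_num) (by positivity)
  have hD0 : 0 ≤ D := by linarith
  nlinarith [mul_le_mul_of_nonneg_left h1 hD0]

end ParamsA

end Params

end Summit.Schanuel.Schanuel.Theorems.RootDecomp1KNW96Core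

end
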